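import Summits.NavierStokesRegularity.NavierStokesRegularity.Theorems.ScenarioCensusModeRankShell
import HarnessLib

/-!
# LINE «mode-rank» port, part 4/4: the separable row `Row_A1sep` / `row_A1sep_holds` (A1sep DECIDED), the OPEN head cell `Row_A1rk`, readings;
# census KEYS `ScenarioCensus.Row_A1sh` / `Row_A1sep` + `_excluded`, `Row_A1rk` (OPEN, `@[conjecture]`)

Re-homed for the scenario census (typer seat ns-census-typer-1 g8; the cells A1sh / A1sep are MEMBERS OF RECORD «DECIDED IN KERNEL IN FILES» of row
A1apT since census v1.71 (critic idea-crit-3 g6 PASS — no price 20:24:04Z; ref ns-census-ref g8 PRE-CHECK ✓ §13.14 item 9; lead-presearch label); this port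
makes them TREE-decided): VERBATIM PORT of ns-idea-2 LINE g12-1 «mode-rank», `pub/ideators/ns-idea-2/lines/mode-rank/line-mode-rank.lean` sha16
fb66c8a2d8442bee (1040 l., lean check rc 0, 0 sorry), split for the 400-line rule into `ScenarioCensusModeRank` (§A1–§A3) → `…ModeRankSpatial` (§A4, §B
instrument) → `…ModeRankShell` (§B decaying shell, `Row_A1sh`) → `…ModeRankRows` (§B separable row, head cell, census KEYS).  Lean text VERBATIM in namespace
`…Theorems.ScenarioCensus.ModeRank` (the line's `…Lines.ModeRank` re-homed); port edits: the two `local notation "E3"` lines (inside `section Spatial` /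
`section Rows`) → one `abbrev E3` at namespace level and the bracket lines `section Rows` / `end Rows` dropped (no `variable`s in that section; typer lint: no
notation in port files), `@[conjecture]` on the OPEN head cell `Row_A1rk` (typed only, no witness); the helper `abs_apply_le_norm` (`|z i| ≤ ‖z‖`, a verbatim twin of a landed
Literature lemma — gate lint `dedup.landed`) is not re-declared and its single use in `curl_eq_zero_of_negShell` is Mathlib's `PiLp.norm_apply_le`; likewise
`tendsto_typeI_bound` (`C/√(-s) → 0`, twin of a landed tree lemma in a module the farm does not build) is not re-declared and its single use in
`tendsto_slice_atBot` carries the one-line Mathlib proof inline (proof text only).  Statements untouched.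

No census VALUE is moved here (row A1apT keeps its value; the members become TREE-decided by name); NS regularity is NOT proved; (L′)
`TypeIAncientLiouville` ⟨10661⟩ is untouched; no summit statement is proved by this file.
-/

-- the summit and its single problem share the name `NavierStokesRegularity` (D-0017 nested layout)
set_option linter.dupNamespace false

noncomputable section

open Set Function Filter Topology

namespace Summit.NavierStokesRegularity.NavierStokesRegularity.Theorems.ScenarioCensus.ModeRank

open Literature.Analysis Literature.Analysis.FluidPDE InnerProductSpace
open Summit.NavierStokesRegularity.NavierStokesRegularity.Theorems (vorticity_eq_deriv_of_typeI)
open scoped Laplacian InnerProductSpace RealInnerProductSpace ContDiff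

/-! ### The separable row -/

/-- `N` is homogeneous of degree two under scaling of the mode: `N(c φ) = c² N(φ)`. -/
theorem vortNL_const_smul {φ : E3 → E3} (hφ : ContDiff ℝ 3 φ) (c : ℝ) (x : E3) :
    vortNL (fun y => c • φ y) x = (c * c) • vortNL φ x := by
  have hcurl : curl (fun y => c • φ y) = fun y => c • curl φ y :=
    funext fun y => curl_const_smul (hφ.differentiable (by norm_num) y) c
  have hd1 : DifferentiableAt ℝ φ x := hφ.differentiable (by norm_num) x
  have hd2 : DifferentiableAt ℝ (curl φ) x :=
    (contDiff_curl (n := 2) hφ).differentiable (by norm_num) x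
  simp only [vortNL, vortB, hcurl]
  rw [fderiv_fun_const_smul hd2, fderiv_fun_const_smul hd1]
  simp only [FunLike.coe_smul, Pi.smul_apply, map_smul, smul_sub, smul_smul]

/-- **Row A1sep (separable slices)** — census A-block cell, (L′)-shape over `IsTypeIAncientMild C u`
BY NAME: if `u(t, x) = a(t) φ(x)` on `t < 0` for one `C³` mode `φ` with bounded curl and an
ARBITRARY amplitude `a : ℝ → ℝ`, then `u ≡ 0` on `t < 0`. -/
def Row_A1sep : Prop :=
  ∀ (C : ℝ) (u : ℝ → E3 → E3), IsTypeIAncientMild C u →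
  ∀ (φ : E3 → E3) (a : ℝ → ℝ), ContDiff ℝ 3 φ → (∃ A : ℝ, ∀ x, ‖curl φ x‖ ≤ A) →
    (∀ t < 0, ∀ x, u t x = a t • φ x) → ∀ t < 0, ∀ x, u t x = 0

/-- **Row A1sep holds** (sorry-free).  Either `curl φ ≡ 0` (gauge step), or the amplitude is read
off the vorticity at one point and is differentiable; the vorticity equation along the mode reads
`a'(t) ω = a(t) Δω − a(t)² N(φ)`.  If `a` takes two distinct non-zero values, elimination gives
`N(φ) = β ω` and `Δω = μ ω` — a single closed shell, `Row_A1sh` with `n = 1`; otherwise `a` is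
constant on `(-∞, 0)` (intermediate value theorem) and a steady slice under the `C/√(-t)` envelope
vanishes. -/
theorem row_A1sep_holds : Row_A1sep := by
  intro C u hu φ a hφ hbd hsl
  have hω2 : ContDiff ℝ 2 (curl φ) := contDiff_curl hφ
  have hsm : IsSmoothSpaceTimeOn (Iio 0) u := hu.contDiffOn
  have hvsm : IsSmoothSpaceTimeOn (Iio 0) (vorticity u) :=
    hsm.isSmoothSpaceTimeOn_vorticity isOpen_Iio.uniqueDiffOn
  have hslF : ∀ s < 0, u s = fun y => a s • φ y := fun s hs => funext (hsl s hs)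
  have hcurlu : ∀ s < 0, ∀ x, curl (u s) x = a s • curl φ x := fun s hs x => by
    rw [hslF s hs]; exact curl_const_smul (hφ.differentiable (by norm_num) x) (a s)
  by_cases hω : ∀ x, curl φ x = 0
  · exact eq_zero_of_curl_slice_const hu fun t ht =>
      ⟨0, fun x => by rw [hcurlu t ht x, hω x, smul_zero]⟩
  push Not at hω
  obtain ⟨x₀, hx₀⟩ := hω
  -- the amplitude read off the vorticity at `x₀`
  have hw₀ : ‖curl φ x₀‖ ^ 2 ≠ 0 := by positivity
  set α : ℝ → ℝ := fun s => ⟪curl (u s) x₀, curl φ x₀⟫ / ‖curl φ x₀‖ ^ 2 with hα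
  have hαa : ∀ s < 0, α s = a s := by
    intro s hs
    simp only [hα]
    rw [hcurlu s hs x₀, real_inner_smul_left, real_inner_self_eq_norm_sq]
    field_simp
  have hαdiff : ∀ t < 0, DifferentiableAt ℝ α t := by
    intro t ht
    have h1 : DifferentiableAt ℝ (fun s => curl (u s) x₀) t := by
      have := (hvsm.hasDerivAt_timeLine isOpen_Iio ht x₀).differentiableAt
      simpa only [vorticity_apply] using this
    exact (h1.inner ℝ (differentiableAt_const _)).div_const _
  have hadiff : ∀ t < 0, DifferentiableAt ℝ a t := fun t ht =>
    (hαdiff t ht).congr_of_eventuallyEq (by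
      filter_upwards [Iio_mem_nhds ht] with s hs
      exact (hαa s hs).symm)
  have hacont : ContinuousOn a (Iio 0) := fun t ht =>
    (hadiff t ht).continuousAt.continuousWithinAt
  -- the vorticity equation along the mode
  have hE : ∀ t < 0, ∀ x, deriv a t • curl φ x =
      a t • (Δ (curl φ)) x - (a t * a t) • vortNL φ x := by
    intro t ht x
    have h2 := vorticity_eq_deriv_of_typeI hu ht x
    have hd : deriv (fun s => curl (u s) x) t = deriv a t • curl φ x := by
      have hev' : (fun s => curl (u s) x) =ᶠ[𝓝 t] fun s => a s • curl φ x := by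
        filter_upwards [Iio_mem_nhds ht] with s hs
        exact hcurlu s hs x
      rw [hev'.deriv_eq]
      exact ((hadiff t ht).hasDerivAt.smul_const (curl φ x)).deriv
    have hcu : curl (u t) = fun y => a t • curl φ y := funext (hcurlu t ht)
    have hΔs : (Δ (fun y => a t • curl φ y)) x = a t • (Δ (curl φ)) x :=
      InnerProductSpace.laplacian_smul (a t) hω2.contDiffAt
    rw [hd, hcu, hslF t ht, fderiv_fun_const_smul (hω2.differentiable (by norm_num) x),
      fderiv_fun_const_smul (hφ.differentiable (by norm_num) x), hΔs] at h2
    simp only [FunLike.coe_smul, Pi.smul_apply, map_smul] at h2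
    have h3 := eq_sub_of_add_eq h2
    rw [h3]
    simp only [vortNL, vortB, smul_sub, smul_smul]
    abel
  by_cases hB : ∃ t₁ t₂, t₁ < 0 ∧ t₂ < 0 ∧ a t₁ ≠ 0 ∧ a t₂ ≠ 0 ∧ a t₁ ≠ a t₂
  · -- two distinct non-zero amplitudes: the mode closes on a single shell
    obtain ⟨t₁, t₂, ht₁, ht₂, ha₁, ha₂, hne⟩ := hB
    have e1 := hE t₁ ht₁
    have e2 := hE t₂ ht₂
    set a₁ := a t₁ with ha₁def
    set a₂ := a t₂ with ha₂def
    set d₁ := deriv a t₁ with hd₁def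
    set d₂ := deriv a t₂ with hd₂def
    have hD : a₁ * a₂ * (a₂ - a₁) ≠ 0 := by
      refine mul_ne_zero (mul_ne_zero ha₁ ha₂) (sub_ne_zero.2 (Ne.symm hne))
    set β : ℝ := (a₁ * a₂ * (a₂ - a₁))⁻¹ * (a₂ * d₁ - a₁ * d₂) with hβ
    have hN : ∀ x, vortNL φ x = β • curl φ x := by
      intro x
      have key : (a₂ * d₁ - a₁ * d₂) • curl φ x = (a₁ * a₂ * (a₂ - a₁)) • vortNL φ x := by
        have h := congrArg (fun v => a₂ • v) (e1 x)
        have h' := congrArg (fun v => a₁ • v) (e2 x)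
        simp only [smul_sub, smul_smul] at h h'
        rw [sub_smul, h, h']
        module
      calc vortNL φ x
          = (a₁ * a₂ * (a₂ - a₁))⁻¹ • ((a₁ * a₂ * (a₂ - a₁)) • vortNL φ x) := by
            rw [smul_smul, inv_mul_cancel₀ hD, one_smul]
        _ = β • curl φ x := by rw [← key, smul_smul]
    set μ : ℝ := a₁⁻¹ * (d₁ + a₁ * a₁ * β) with hμ
    have hL : ∀ x, (Δ (curl φ)) x = μ • curl φ x := by
      intro x
      have key : a₁ • (Δ (curl φ)) x = (d₁ + a₁ * a₁ * β) • curl φ x := by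
        have h := e1 x
        rw [hN x, smul_smul] at h
        rw [add_smul, h]
        abel
      calc (Δ (curl φ)) x = a₁⁻¹ • (a₁ • (Δ (curl φ)) x) := by
            rw [smul_smul, inv_mul_cancel₀ ha₁, one_smul]
        _ = μ • curl φ x := by rw [key, smul_smul]
    refine row_A1sh_holds C u hu 1 (fun _ => φ) μ (fun _ => hφ) (fun _ => hbd) (fun _ x => hL x)
      ?_ ?_
    · intro c
      refine ⟨fun _ => c 0 * c 0 * β, fun x => ?_⟩
      simp only [Fin.sum_univ_zero, Fin.sum_univ_succ, add_zero]
      rw [vortNL_const_smul hφ, hN x, smul_smul]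
    · intro t ht
      exact ⟨fun _ => a t, fun x => by simp [hsl t ht x]⟩
  · -- otherwise the amplitude is constant on `(-∞, 0)`
    push Not at hB
    by_cases hZ : ∀ t < 0, a t = 0
    · intro t ht x
      rw [hsl t ht x, hZ t ht, zero_smul]
    push Not at hZ
    obtain ⟨t₀, ht₀, hA0⟩ := hZ
    have hconstA : ∀ t < 0, a t = a t₀ := by
      intro t ht
      by_contra hne
      have hat : a t = 0 := by
        by_contra h
        exact hne (hB t t₀ ht ht₀ h hA0)
      have hmid : a t₀ / 2 ∈ a '' Iio 0 := by
        rcases le_or_gt 0 (a t₀) with hA | hA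
        · exact isPreconnected_Iio.intermediate_value ht ht₀ hacont
            ⟨by rw [hat]; linarith, by linarith⟩
        · exact isPreconnected_Iio.intermediate_value ht₀ ht hacont
            ⟨by linarith, by rw [hat]; linarith⟩
      obtain ⟨s, hs, hsa⟩ := hmid
      have hs0 : a s ≠ 0 := by rw [hsa]; exact div_ne_zero hA0 two_ne_zero
      have h := hB s t₀ hs ht₀ hs0 hA0
      rw [hsa] at h
      exact hA0 (by linarith)
    intro t ht x
    have hlim := tendsto_slice_atBot hu x
    have hev2 : (fun _ : ℝ => a t₀ • φ x) =ᶠ[atBot] fun s => u s x := by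
      filter_upwards [Iio_mem_atBot 0] with s hs
      rw [hsl s hs x, hconstA s hs]
    have h2 : Tendsto (fun s => u s x) atBot (𝓝 (a t₀ • φ x)) :=
      tendsto_const_nhds.congr' hev2
    have h3 : a t₀ • φ x = 0 := tendsto_nhds_unique h2 hlim
    rw [hsl t ht x, hconstA t ht, h3]

/-! ### The open head cell and the readings -/

/-- **Row A1rk (finite mode rank)** — the HEAD cell of the instrument, TYPED ONLY (open): a
Type-I ancient mild field whose slices span a finite-dimensional space of `C³` modes with bounded
curls vanishes — with NO shell hypothesis and NO closure hypothesis.  `Row_A1rk → Row_A1sh` is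
trivial (`row_A1sh_of_row_A1rk`); the converse is a must-fail probe.  A proof would have to run the
slow-to-fast elimination of `Row_A1sep` on a multi-mode amplitude vector, where the two-time trick
is replaced by Zariski-closure bookkeeping of the amplitude curve; not attempted here. -/
@[conjecture] def Row_A1rk : Prop :=
  ∀ (C : ℝ) (u : ℝ → E3 → E3), IsTypeIAncientMild C u →
  ∀ (n : ℕ) (φ : Fin n → E3 → E3),
    (∀ i, ContDiff ℝ 3 (φ i)) →
    (∀ i, ∃ A : ℝ, ∀ x, ‖curl (φ i) x‖ ≤ A) →
    (∀ t < 0, ∃ a : Fin n → ℝ, ∀ x, u t x = ∑ i, a i • φ i x) →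
    ∀ t < 0, ∀ x, u t x = 0

/-- The head cell implies the single-shell cell (drop two hypotheses). -/
theorem row_A1sh_of_row_A1rk (h : Row_A1rk) : Row_A1sh :=
  fun C u hu n φ _μ hφ hbd _hΔ _hcl hsl => h C u hu n φ hφ hbd hsl

/-- The head cell implies the separable cell (one mode). -/
theorem row_A1sep_of_row_A1rk (h : Row_A1rk) : Row_A1sep :=
  fun C u hu φ a hφ hbd hsl => h C u hu 1 (fun _ => φ) (fun _ => hφ) (fun _ => hbd)
    (fun t ht => ⟨fun _ => a t, fun x => by simp [hsl t ht x]⟩)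

/-- **Reading (census prose).** In the KNSS Type-I ancient mild class there is no non-zero element
with single-shell Galerkin slices and none with separable slices: both cells are decided. -/
theorem modeRank_cells_decided : Row_A1sh ∧ Row_A1sep := ⟨row_A1sh_holds, row_A1sep_holds⟩

end Summit.NavierStokesRegularity.NavierStokesRegularity.Theorems.ScenarioCensus.ModeRank

namespace Summit.NavierStokesRegularity.NavierStokesRegularity.Theorems.ScenarioCensus

/-! ## Census KEYS (ns `…Theorems.ScenarioCensus`): instrument MODE RANK on row A1apT — TREE-decided members A1sh / A1sep, OPEN head A1rk -/

/-- **Cell A1sh** (single-shell Galerkin slices: every slice of a Type-I ancient mild field lies in the span of finitely many `C³` modes with bounded curls, all curls in ONE eigenspace of the vector Laplacian, vorticity nonlinearity closing on the span ⇒ `u ≡ 0`): `:= ModeRank.Row_A1sh`. DECIDED. -/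
def Row_A1sh : Prop := ModeRank.Row_A1sh
/-- A1sh is EXCLUDED (decided in the tree): `ModeRank.row_A1sh_holds`. -/
theorem row_A1sh_excluded : Row_A1sh := ModeRank.row_A1sh_holds

/-- **Cell A1sep** (separable slices `u(t,x) = a(t) φ(x)`, `φ ∈ C³` with bounded curl, `a` arbitrary ⇒ `u ≡ 0`): `:= ModeRank.Row_A1sep`. DECIDED. -/
def Row_A1sep : Prop := ModeRank.Row_A1sep
/-- A1sep is EXCLUDED (decided in the tree): `ModeRank.row_A1sep_holds`. -/
theorem row_A1sep_excluded : Row_A1sep := ModeRank.row_A1sep_holds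

/-- **Cell A1rk** (finite mode rank, no shell and no closure hypothesis ⇒ `u ≡ 0`) — the OPEN head cell of the instrument, typed only: `:= ModeRank.Row_A1rk`. OPEN (no witness, no proof). -/
@[conjecture] def Row_A1rk : Prop := ModeRank.Row_A1rk

/-- Lattice edge at key level: the OPEN head cell A1rk implies the decided cell A1sh (`ModeRank.row_A1sh_of_row_A1rk`). -/
theorem row_A1sh_of_row_A1rk : Row_A1rk → Row_A1sh := ModeRank.row_A1sh_of_row_A1rk
/-- Lattice edge at key level: the OPEN head cell A1rk implies the decided cell A1sep (`ModeRank.row_A1sep_of_row_A1rk`). -/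
theorem row_A1sep_of_row_A1rk : Row_A1rk → Row_A1sep := ModeRank.row_A1sep_of_row_A1rk

end Summit.NavierStokesRegularity.NavierStokesRegularity.Theorems.ScenarioCensus

end
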